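import Summits.KontsevichZagierPeriods.KontsevichZagierPeriods.Theorems.SymplecticScissorsRealOnePeriodRelationsStubSaHomotopicAux

/-!
# Stub `stub_saHomotopic` of crux `SymplecticScissors.RealOnePeriodRelations`
# (stmt-KontsevichZagierPeriods-10042, line `nash-retraction-thin-strip`) — the data and the new path

* `re_im_comp_holds` — the realified composition of a `ℚ`-semialgebraic path `ℝ → ℂⁿ` with a
  `ℚ`-semialgebraic function `[0,1] → [0,1]` is semialgebraic (Tarski–Seidenberg, from the tree's
  `IsSemialgebraicMapOn.comp_holds`);
* `SaData Z γ` — the data of the construction for a `C¹` path `γ` on `Z`: `N` pieces, chart regions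
  `Ω_r ⊇ γ([r/N,(r+1)/N])` with graph charts `ψ_r`, algebraic break points `b_r`, links `λ_r` and
  semialgebraic `C¹` pieces `σ_r`;
* `SaData.newPath` — the new path `γ' = b₀ + Σ_r (σ_r(φ(N t − r)) − b_r)`; it is `C¹`
  (`contDiff_newPath`), lies on `Z` with the right end points, and is `ℚ`-semialgebraic
  (`isSemialgebraicMapOn_newPath`).

References: A. Huber, G. Wüstholz, *Transcendence and Linear Relations of 1-Periods* (CUP 2022),
§3.3.1; J. Bochnak, M. Coste, M.-F. Roy, *Real Algebraic Geometry* (1998), §2.2.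
-/

noncomputable section

open scoped BigOperators Topology unitInterval
open Set Filter Metric MvPolynomial
open Literature.NumberTheory.Transcendental Literature.NumberTheory.Transcendental.CurvePeriods
open Literature.ModelTheory.ExponentialFields (IsSemialgebraic)

namespace Summit.KontsevichZagierPeriods.SymplecticScissors.RealOnePeriodRelations.SaHomotopic

/-! ### Semialgebraicity of realified compositions -/

/-- The parameter domain `{z : ℝ¹ | z₀ ∈ [0,1]}` is `ℚ`-semialgebraic. [cite: BochnakCosteRoy1998, §2.1] -/
theorem isSemialgebraic_paramDom :
    IsSemialgebraic ℚ {z : Fin 1 → ℝ | z 0 ∈ Icc (0 : ℝ) 1} := by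
  have h0 := Literature.ModelTheory.ExponentialFields.isSemialgebraic_setOf_eval_le (k := ℚ)
    (R := ℝ) (ι := Fin 1) 0 (X 0)
  have h1 := Literature.ModelTheory.ExponentialFields.isSemialgebraic_setOf_eval_le (k := ℚ)
    (R := ℝ) (ι := Fin 1) (X 0) 1
  have hset : {z : Fin 1 → ℝ | z 0 ∈ Icc (0 : ℝ) 1} =
      {x : Fin 1 → ℝ | aeval x (0 : MvPolynomial (Fin 1) ℚ) ≤ aeval x (X 0 : MvPolynomial (Fin 1) ℚ)} ∩
        {x : Fin 1 → ℝ | aeval x (X 0 : MvPolynomial (Fin 1) ℚ) ≤ aeval x (1 : MvPolynomial (Fin 1) ℚ)} := by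
    ext z
    simp [mem_Icc]
  rw [hset]
  exact h0.inter h1

/-- **Realified composition.** If the realification `t ↦ (re c(t), im c(t))` of
`c : ℝ → ℂⁿ` is a `ℚ`-semialgebraic map on `{z | z₀ ∈ [0,1]}` and `g : ℝ → [0,1]` is a
`ℚ`-semialgebraic function there, then so are the real and imaginary parts of every coordinate of
`t ↦ c(g(t))` (composition of semialgebraic maps, Tarski–Seidenberg).
[cite: BochnakCosteRoy1998, Prop. 2.2.6] -/
theorem re_im_comp_holds {n : ℕ} {c : ℝ → (Fin n → ℂ)}
    (hc : IsSemialgebraicMapOn ℚ {z : Fin 1 → ℝ | z 0 ∈ Icc (0 : ℝ) 1}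
      (fun z => Fin.append (fun i => (c (z 0) i).re) (fun i => (c (z 0) i).im)))
    {g : ℝ → ℝ} (hg : IsSemialgebraicFunOn ℚ {z : Fin 1 → ℝ | z 0 ∈ Icc (0 : ℝ) 1} (fun z => g (z 0)))
    (hmaps : ∀ t, g t ∈ Icc (0 : ℝ) 1) (i : Fin n) :
    IsSemialgebraicFunOn ℚ {z : Fin 1 → ℝ | z 0 ∈ Icc (0 : ℝ) 1} (fun z => (c (g (z 0)) i).re) ∧
      IsSemialgebraicFunOn ℚ {z : Fin 1 → ℝ | z 0 ∈ Icc (0 : ℝ) 1} (fun z => (c (g (z 0)) i).im) := by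
  set D : Set (Fin 1 → ℝ) := {z : Fin 1 → ℝ | z 0 ∈ Icc (0 : ℝ) 1} with hD
  have hDs : IsSemialgebraic ℚ D := isSemialgebraic_paramDom
  let Φ : (Fin 1 → ℝ) → (Fin 1 → ℝ) := fun z _ => g (z 0)
  have hΦ : IsSemialgebraicMapOn ℚ D Φ := IsSemialgebraicMapOn.of_forall hDs fun _ => hg
  have hΦD : MapsTo Φ D D := fun z _ => hmaps (z 0)
  have hcomp := IsSemialgebraicMapOn.comp_holds hc hΦ hΦD
  have hcoord := (isSemialgebraicMapOn_iff_forall_holds hDs).mp hcomp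
  refine ⟨(hcoord (Fin.castAdd n i)).congr fun z _ => ?_,
    (hcoord (Fin.natAdd n i)).congr fun z _ => ?_⟩
  · show Fin.append (fun i => (c (g (z 0)) i).re) (fun i => (c (g (z 0)) i).im)
      (Fin.castAdd n i) = _
    rw [Fin.append_left]
  · show Fin.append (fun i => (c (g (z 0)) i).re) (fun i => (c (g (z 0)) i).im)
      (Fin.natAdd n i) = _
    rw [Fin.append_right]

/-! ### The extension of a `C¹` path to `ℝ` -/

variable {Z : CurveData}

/-- The continuous extension of a `C¹` path on `Z` to all of `ℝ` (constant outside `[0,1]`).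
[folklore] -/
def pext (γ : CurvePath Z) (t : ℝ) : Fin Z.n → ℂ := ((γ.toPath.extend t : Z.points) : Fin Z.n → ℂ)

/-- The extension is continuous. [folklore] -/
theorem continuous_pext (γ : CurvePath Z) : Continuous (pext γ) :=
  continuous_subtype_val.comp γ.toPath.continuous_extend

/-- The extension takes values on `Z`. [folklore] -/
theorem pext_mem (γ : CurvePath Z) (t : ℝ) : pext γ t ∈ Z.points := (γ.toPath.extend t).2

/-- On `[0,1]` the extension is `γ`. [folklore] -/
theorem pext_of_mem (γ : CurvePath Z) {t : ℝ} (ht : t ∈ Icc (0 : ℝ) 1) : pext γ t = γ.toFun t := by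
  show ((γ.toPath.extend t : Z.points) : Fin Z.n → ℂ) = _
  rw [Path.extend_apply γ.toPath ht]
  rfl

/-! ### The data of the construction -/

/-- **The data of the construction** of a semialgebraic representative of the homotopy class of
`γ`: a subdivision of `[0,1]` into `N` pieces, for each piece a chart region `Ω_r` (graph chart
`ψ_r` over the coordinate `i_r`, convex coordinate disc `T_r`) containing `γ([r/N,(r+1)/N])`,
algebraic break points `b_r` (`b₀ = γ(0)`, `b_N = γ(1)`), continuous links `λ_r` from `γ(r/N)`
to `b_r` inside `Ω_{r−1} ∩ Ω_r ∩ Z(ℂ)`, and semialgebraic `C¹` pieces `σ_r` from `b_r` to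
`b_{r+1}` inside `Ω_r`. [cite: HuberWustholz2022, §3.3.1] -/
structure SaData (Z : CurveData) (γ : CurvePath Z) where
  /-- The number of pieces. -/
  N : ℕ
  /-- There is at least one piece. -/
  hN : 0 < N
  /-- The chart region of the `r`-th piece. -/
  Ω : ℕ → Set (Fin Z.n → ℂ)
  /-- The coordinate disc of the `r`-th chart. -/
  T : ℕ → Set ℂ
  /-- The `r`-th graph chart. -/
  ψ : ℕ → ℂ → (Fin Z.n → ℂ)
  /-- The free coordinate of the `r`-th chart. -/
  i : ℕ → Fin Z.n
  /-- The coordinate discs are convex. -/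
  hTc : ∀ r, Convex ℝ (T r)
  /-- The charts are continuous on their discs. -/
  hψc : ∀ r, ContinuousOn (ψ r) (T r)
  /-- The chart retracts `Ω_r ∩ Z(ℂ)` onto the graph. -/
  h1 : ∀ r, ∀ z ∈ Ω r, z ∈ Z.points → z (i r) ∈ T r ∧ ψ r (z (i r)) = z
  /-- The chart maps the disc into `Ω_r ∩ Z(ℂ)`. -/
  h2 : ∀ r, ∀ w ∈ T r, ψ r w ∈ Ω r ∧ ψ r w ∈ Z.points
  /-- The `r`-th piece of `γ` lies in `Ω_r`. -/
  hPΩ : ∀ r, r < N → ∀ t ∈ Icc ((r : ℝ) / N) (((r : ℝ) + 1) / N), pext γ t ∈ Ω r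
  /-- The break points. -/
  b : ℕ → (Fin Z.n → ℂ)
  /-- The first break point is `γ(0)`. -/
  hb0 : b 0 = γ.toFun 0
  /-- The last break point is `γ(1)`. -/
  hbN : b N = γ.toFun 1
  /-- The break points are algebraic. -/
  hbalg : ∀ r, r ≤ N → ∀ j, IsAlgebraic ℚ (b r j)
  /-- The links. -/
  lam : ℕ → ℝ → (Fin Z.n → ℂ)
  /-- The links are continuous. -/
  hlamc : ∀ r, r ≤ N → Continuous (lam r)
  /-- The `r`-th link starts at `γ(r/N)`. -/
  hlam0 : ∀ r, r ≤ N → lam r 0 = pext γ ((r : ℝ) / N)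
  /-- The `r`-th link ends at `b_r`. -/
  hlam1 : ∀ r, r ≤ N → lam r 1 = b r
  /-- The first link is constant. -/
  hlam00 : ∀ v, lam 0 v = γ.toFun 0
  /-- The last link is constant. -/
  hlamNN : ∀ v, lam N v = γ.toFun 1
  /-- The `r`-th link lies in `Ω_r ∩ Z(ℂ)`. -/
  hlamΩ : ∀ r, r < N → ∀ v, lam r v ∈ Ω r ∧ lam r v ∈ Z.points
  /-- The `(r+1)`-st link lies in `Ω_r ∩ Z(ℂ)`. -/
  hlamΩ' : ∀ r, r < N → ∀ v, lam (r + 1) v ∈ Ω r ∧ lam (r + 1) v ∈ Z.points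
  /-- The semialgebraic `C¹` pieces. -/
  sg : ℕ → CurvePath Z
  /-- The pieces are `ℚ`-semialgebraic (realified). -/
  hsgsa : ∀ r, r < N → IsSemialgebraicMapOn ℚ {z : Fin 1 → ℝ | z 0 ∈ Icc (0 : ℝ) 1}
    (fun z => Fin.append (fun i => ((sg r).toFun (z 0) i).re) (fun i => ((sg r).toFun (z 0) i).im))
  /-- The `r`-th piece starts at `b_r`. -/
  hsg0 : ∀ r, r < N → (sg r).toFun 0 = b r
  /-- The `r`-th piece ends at `b_{r+1}`. -/
  hsg1 : ∀ r, r < N → (sg r).toFun 1 = b (r + 1)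
  /-- The `r`-th piece lies in `Ω_r`. -/
  hsgΩ : ∀ r, r < N → ∀ t ∈ Icc (0 : ℝ) 1, (sg r).toFun t ∈ Ω r

/-! ### Arithmetic of the subdivision -/

/-- Right of the piece `r < k`: `(r+1)/N ≤ t` for `k/N ≤ t`. [folklore] -/
theorem succ_div_le_of_lt {N r k : ℕ} (hr : r < k) {t : ℝ} (ht : (k : ℝ) / N ≤ t) :
    ((r : ℝ) + 1) / N ≤ t :=
  le_trans (div_le_div_of_nonneg_right (by exact_mod_cast Nat.succ_le_of_lt hr) (Nat.cast_nonneg N)) ht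

/-- Left of the piece `k < r`: `t ≤ r/N` for `t ≤ (k+1)/N`. [folklore] -/
theorem le_div_of_lt {N r k : ℕ} (hkr : k < r) {t : ℝ} (ht : t ≤ ((k : ℝ) + 1) / N) :
    t ≤ (r : ℝ) / N :=
  le_trans ht (div_le_div_of_nonneg_right (by exact_mod_cast Nat.succ_le_of_lt hkr) (Nat.cast_nonneg N))

/-- The local parameter `N t − r` is `≥ 1` right of the piece. [folklore] -/
theorem one_le_local {N r : ℕ} (hN : 0 < N) {t : ℝ} (ht : ((r : ℝ) + 1) / N ≤ t) :
    1 ≤ (N : ℝ) * t - r := by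
  have hN' : (0 : ℝ) < N := by exact_mod_cast hN
  have := (div_le_iff₀ hN').mp ht
  linarith [mul_comm (N : ℝ) t]

/-- The local parameter `N t − r` is `≤ 0` left of the piece. [folklore] -/
theorem local_nonpos {N r : ℕ} (hN : 0 < N) {t : ℝ} (ht : t ≤ (r : ℝ) / N) :
    (N : ℝ) * t - r ≤ 0 := by
  have hN' : (0 : ℝ) < N := by exact_mod_cast hN
  have := (le_div_iff₀ hN').mp ht
  linarith [mul_comm (N : ℝ) t]

/-- `((N − 1) + 1)/N = 1`. [folklore] -/
theorem pred_add_one_div {N : ℕ} (hN : 0 < N) : (((N - 1 : ℕ) : ℝ) + 1) / N = 1 := by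
  have hN' : (0 : ℝ) < N := by exact_mod_cast hN
  rw [Nat.cast_sub (Nat.one_le_of_lt hN)]
  push_cast
  rw [sub_add_cancel, div_self hN'.ne']

/-- `1` lies in the last piece interval. [folklore] -/
theorem one_mem_lastPiece {N : ℕ} (hN : 0 < N) :
    (1 : ℝ) ∈ Icc (((N - 1 : ℕ) : ℝ) / N) ((((N - 1 : ℕ) : ℝ) + 1) / N) := by
  have hN' : (0 : ℝ) < N := by exact_mod_cast hN
  exact ⟨(div_le_one hN').mpr (by exact_mod_cast Nat.sub_le N 1), by rw [pred_add_one_div hN]⟩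

/-- `0` lies in the first piece interval. [folklore] -/
theorem zero_mem_firstPiece {N : ℕ} :
    (0 : ℝ) ∈ Icc (((0 : ℕ) : ℝ) / N) ((((0 : ℕ) : ℝ) + 1) / N) := by
  simp only [Nat.cast_zero, zero_div, zero_add]
  exact ⟨le_rfl, by positivity⟩

/-- A piece interval lies in `[0,1]`. [folklore] -/
theorem piece_subset {N k : ℕ} (hN : 0 < N) (hk : k < N) :
    Icc ((k : ℝ) / N) (((k : ℝ) + 1) / N) ⊆ Icc (0 : ℝ) 1 := fun t ht => by
  have hN' : (0 : ℝ) < N := by exact_mod_cast hN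
  exact ⟨le_trans (by positivity) ht.1,
    le_trans ht.2 ((div_le_one hN').mpr (by exact_mod_cast Nat.succ_le_of_lt hk))⟩

namespace SaData

variable {γ : CurvePath Z} (D : SaData Z γ)

/-- `(r+1 : ℕ)/N = (r + 1)/N` (cast bookkeeping). [folklore] -/
theorem cast_succ_div (N r : ℕ) : (((r + 1 : ℕ) : ℝ)) / N = ((r : ℝ) + 1) / N := by
  push_cast
  rfl

/-- The `(r+1)`-st link starts at `γ((r+1)/N)`. [folklore] -/
theorem hlam0' {r : ℕ} (hr : r < D.N) : D.lam (r + 1) 0 = pext γ (((r : ℝ) + 1) / D.N) := by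
  rw [D.hlam0 (r + 1) (Nat.succ_le_of_lt hr), cast_succ_div]

/-- The break point `b_r`, `r < N`, lies in `Ω_r ∩ Z(ℂ)`. [folklore] -/
theorem hbΩ {r : ℕ} (hr : r < D.N) : D.b r ∈ D.Ω r ∧ D.b r ∈ Z.points := by
  rw [← D.hlam1 r hr.le]
  exact D.hlamΩ r hr 1

/-- The break point `b_{r+1}`, `r < N`, lies in `Ω_r ∩ Z(ℂ)`. [folklore] -/
theorem hbΩ' {r : ℕ} (hr : r < D.N) : D.b (r + 1) ∈ D.Ω r ∧ D.b (r + 1) ∈ Z.points := by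
  rw [← D.hlam1 (r + 1) (Nat.succ_le_of_lt hr)]
  exact D.hlamΩ' r hr 1

/-! ### The new path `γ'` -/

/-- **The semialgebraic representative** `γ'(t) = b₀ + Σ_r (σ_r(φ(N t − r)) − b_r)`: on the `k`-th
piece it is `σ_k(φ(N t − k))`. [cite: HuberWustholz2022, §3.3.1] -/
def newPath (t : ℝ) : Fin Z.n → ℂ :=
  D.b 0 + ∑ r ∈ Finset.range D.N, ((D.sg r).toFun (flatStep ((D.N : ℝ) * t - r)) - D.b r)

/-- The `r`-th summand right of its piece. [folklore] -/
theorem sg_flatStep_of_ge {r : ℕ} (hr : r < D.N) {t : ℝ} (ht : ((r : ℝ) + 1) / D.N ≤ t) :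
    (D.sg r).toFun (flatStep ((D.N : ℝ) * t - r)) = D.b (r + 1) := by
  rw [flatStep_of_one_le (one_le_local D.hN ht), D.hsg1 r hr]

/-- The `r`-th summand left of its piece. [folklore] -/
theorem sg_flatStep_of_le {r : ℕ} (hr : r < D.N) {t : ℝ} (ht : t ≤ (r : ℝ) / D.N) :
    (D.sg r).toFun (flatStep ((D.N : ℝ) * t - r)) = D.b r := by
  rw [flatStep_of_nonpos (local_nonpos D.hN ht), D.hsg0 r hr]

/-- Evaluation of `γ'` on the `k`-th piece. [folklore] -/
theorem newPath_eval {k : ℕ} (hk : k < D.N) {t : ℝ}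
    (ht : t ∈ Icc ((k : ℝ) / D.N) (((k : ℝ) + 1) / D.N)) :
    D.newPath t = (D.sg k).toFun (flatStep ((D.N : ℝ) * t - k)) := by
  unfold newPath
  refine telescope_eval D.b (fun r => (D.sg r).toFun (flatStep ((D.N : ℝ) * t - r))) hk
    (fun r hr => D.sg_flatStep_of_ge (hr.trans hk) (succ_div_le_of_lt hr ht.1))
    (fun r hkr hrN => D.sg_flatStep_of_le hrN (le_div_of_lt hkr ht.2))

/-- `γ'` is `C¹` on `ℝ` (a finite sum of `C¹` maps: `σ_r` is `C¹` on `[0,1]` and `φ` is `C¹`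
with values in `[0,1]`). [folklore] -/
theorem contDiff_newPath : ContDiff ℝ 1 D.newPath := by
  unfold newPath
  refine contDiff_const.add (ContDiff.sum fun r _ => ContDiff.sub ?_ contDiff_const)
  exact (D.sg r).contDiffOn.comp_contDiff
    (contDiff_flatStep.comp ((contDiff_const.mul contDiff_id).sub contDiff_const))
    (fun _ => flatStep_mem _)

/-- `γ'` is continuous. [folklore] -/
theorem continuous_newPath : Continuous D.newPath := D.contDiff_newPath.continuous

/-- On the `k`-th piece `γ'` lies in `Ω_k ∩ Z(ℂ)`. [folklore] -/
theorem newPath_memΩ {k : ℕ} (hk : k < D.N) {t : ℝ}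
    (ht : t ∈ Icc ((k : ℝ) / D.N) (((k : ℝ) + 1) / D.N)) :
    D.newPath t ∈ D.Ω k ∧ D.newPath t ∈ Z.points := by
  rw [D.newPath_eval hk ht]
  exact ⟨D.hsgΩ k hk _ (flatStep_mem _), (D.sg k).mem_points _ (flatStep_mem _)⟩

/-- `γ'([0,1]) ⊆ Z(ℂ)`. [folklore] -/
theorem newPath_mem {t : ℝ} (ht : t ∈ Icc (0 : ℝ) 1) : D.newPath t ∈ Z.points := by
  obtain ⟨k, hk, hk1, hk2⟩ := exists_piece_index D.hN ht
  exact (D.newPath_memΩ hk ⟨hk1, hk2⟩).2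

/-- `γ'(0) = γ(0)`. [folklore] -/
theorem newPath_zero : D.newPath 0 = γ.toFun 0 := by
  rw [D.newPath_eval D.hN zero_mem_firstPiece, ← D.hb0]
  have := D.sg_flatStep_of_le D.hN (r := 0) (t := 0) (by simp)
  simpa using this

/-- `γ'(1) = γ(1)`. [folklore] -/
theorem newPath_one : D.newPath 1 = γ.toFun 1 := by
  have hk : D.N - 1 < D.N := Nat.sub_lt D.hN one_pos
  rw [D.newPath_eval hk (one_mem_lastPiece D.hN), ← D.hbN,
    D.sg_flatStep_of_ge hk (by rw [pred_add_one_div D.hN]), Nat.sub_add_cancel (Nat.one_le_of_lt D.hN)]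

/-- **`γ'` is `ℚ`-semialgebraic** (realified): each summand is a realified composition of the
semialgebraic `σ_r` with the semialgebraic `t ↦ φ(N t − r)`, the constants `b_r` are algebraic.
[cite: BochnakCosteRoy1998, Prop. 2.2.6] -/
theorem isSemialgebraicMapOn_newPath :
    IsSemialgebraicMapOn ℚ {z : Fin 1 → ℝ | z 0 ∈ Icc (0 : ℝ) 1}
      (fun z => Fin.append (fun i => (D.newPath (z 0) i).re) (fun i => (D.newPath (z 0) i).im)) := by
  have hD := isSemialgebraic_paramDom
  have hterm : ∀ r ∈ Finset.range D.N, ∀ i,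
      IsSemialgebraicFunOn ℚ {z : Fin 1 → ℝ | z 0 ∈ Icc (0 : ℝ) 1}
        (fun z => ((D.sg r).toFun (flatStep ((D.N : ℝ) * z 0 - r)) i).re) ∧
      IsSemialgebraicFunOn ℚ {z : Fin 1 → ℝ | z 0 ∈ Icc (0 : ℝ) 1}
        (fun z => ((D.sg r).toFun (flatStep ((D.N : ℝ) * z 0 - r)) i).im) := fun r hr i =>
    re_im_comp_holds (c := (D.sg r).toFun) (g := fun t => flatStep ((D.N : ℝ) * t - r))
      (D.hsgsa r (Finset.mem_range.mp hr))
      (isSemialgebraicFunOn_flatStep_affine hD D.N r) (fun t => flatStep_mem _) i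
  have hconst : ∀ r, r ≤ D.N → ∀ i,
      IsSemialgebraicFunOn ℚ {z : Fin 1 → ℝ | z 0 ∈ Icc (0 : ℝ) 1} (fun _ => (D.b r i).re) ∧
      IsSemialgebraicFunOn ℚ {z : Fin 1 → ℝ | z 0 ∈ Icc (0 : ℝ) 1} (fun _ => (D.b r i).im) :=
    fun r hr i => re_im_const hD (isAlgebraic_re_im (D.hbalg r hr i)).1
      (isAlgebraic_re_im (D.hbalg r hr i)).2
  refine IsSemialgebraicMapOn.of_forall hD fun j => ?_
  refine Fin.addCases (fun i => ?_) (fun i => ?_) j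
  · have he : (fun z : Fin 1 → ℝ => Fin.append (fun i => (D.newPath (z 0) i).re)
        (fun i => (D.newPath (z 0) i).im) (Fin.castAdd Z.n i)) = fun z => (D.b 0 i).re +
          ∑ r ∈ Finset.range D.N,
            (((D.sg r).toFun (flatStep ((D.N : ℝ) * z 0 - r)) i).re - (D.b r i).re) := by
      funext z
      rw [Fin.append_left]
      simp [newPath, Finset.sum_apply, Complex.re_sum]
    rw [he]
    exact (hconst 0 (Nat.zero_le _) i).1.fun_add (IsSemialgebraicFunOn.fun_finsetSum _ hD
      fun r hr => (hterm r hr i).1.fun_sub (hconst r (Finset.mem_range.mp hr).le i).1)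
  · have he : (fun z : Fin 1 → ℝ => Fin.append (fun i => (D.newPath (z 0) i).re)
        (fun i => (D.newPath (z 0) i).im) (Fin.natAdd Z.n i)) = fun z => (D.b 0 i).im +
          ∑ r ∈ Finset.range D.N,
            (((D.sg r).toFun (flatStep ((D.N : ℝ) * z 0 - r)) i).im - (D.b r i).im) := by
      funext z
      rw [Fin.append_right]
      simp [newPath, Finset.sum_apply, Complex.im_sum]
    rw [he]
    exact (hconst 0 (Nat.zero_le _) i).2.fun_add (IsSemialgebraicFunOn.fun_finsetSum _ hD
      fun r hr => (hterm r hr i).2.fun_sub (hconst r (Finset.mem_range.mp hr).le i).2)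

end SaData

end Summit.KontsevichZagierPeriods.SymplecticScissors.RealOnePeriodRelations.SaHomotopic

namespace Summit.KontsevichZagierPeriods.SymplecticScissors.RealOnePeriodRelations

/-- HELPER STUB `helper_saHomotopic_2` (registered on stmt-KontsevichZagierPeriods-10042): realified
composition of a semialgebraic path with a semialgebraic function `[0,1] → [0,1]` is semialgebraic
(= `SaHomotopic.re_im_comp_holds`). [cite: BochnakCosteRoy1998, Prop. 2.2.6] -/
theorem helper_saHomotopic_2 :
    ∀ {n : ℕ} {c : ℝ → (Fin n → ℂ)}, IsSemialgebraicMapOn ℚ {z : Fin 1 → ℝ | z 0 ∈ Set.Icc (0 : ℝ)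
    1} (fun z => Fin.append (fun i => (c (z 0) i).re) (fun i => (c (z 0) i).im)) → ∀ {g : ℝ → ℝ},
    IsSemialgebraicFunOn ℚ {z : Fin 1 → ℝ | z 0 ∈ Set.Icc (0 : ℝ) 1} (fun z => g (z 0)) → (∀ t, g t
    ∈ Set.Icc (0 : ℝ) 1) → ∀ i : Fin n, IsSemialgebraicFunOn ℚ {z : Fin 1 → ℝ | z 0 ∈ Set.Icc (0 :
    ℝ) 1} (fun z => (c (g (z 0)) i).re) ∧ IsSemialgebraicFunOn ℚ {z : Fin 1 → ℝ | z 0 ∈ Set.Icc (0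
    : ℝ) 1} (fun z => (c (g (z 0)) i).im) :=
  fun hc _ hg hmaps i => SaHomotopic.re_im_comp_holds hc hg hmaps i

end Summit.KontsevichZagierPeriods.SymplecticScissors.RealOnePeriodRelations

end
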